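import Literature.NumberTheory.EllipticCurves.Rank1Residual.Typed.CasselsLowerBound
import HarnessLib

/-!
# Cassels–Tate: an element of order `m` in `Ш(E/K)` forces `m² ∣ #Ш(E/K)` — the kernel input of the
# `Ш[9]`-visibility road for the SHA81 rows (cell `b2b-bsdres`, team n1011, seat p05 GEN 12; row
# T-SHA81-DIM3 FILE 2′; skeleton `cells/n1011/skel/T-SHA81-DIM3.md`)

HONEST FRAMING (cell `b2b-bsdres`, run/shared/lean/b2b/bsd-rank1-residual/, verbatim in every
file): the goal of the cell is to DELETE the COMBINATION-SHAPED residual classes of the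
Birch–Swinnerton-Dyer formula for ALL analytic-rank `≤ 1` elliptic curves over `ℚ` — "full BSD
formula for every rank `≤ 1` curve in class `C`" assembled STRICTLY from published theorems — so
that the rank-`≤ 1` remainder becomes exactly the CONSTRUCTION-SHAPED classes, which are TYPED
(missing-input `Prop`s), NOT attempted. This is not "finishing BSD". Team n1011 (N10 / N11):
research route on the CONSTRUCTION-SHAPED class X4; no claim beyond the stated classes; nothing is
booked; marks UNCHANGED. Theorems only: no definition, no named fact, no `sorry`. TOOL theorems
(any finite abelian group; any number field `K`); they close nothing by themselves — the
Cassels–Tate pairing enters as the displayed named fact `WeierstrassCurve.exists_casselsTate_pairing`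
(bsd.S18) exactly as in the tree's `isSquare_card_sha_of_finite_of_casselsTate`.

## What and why

On the SHA81 rows of team n1011 (`ord₃ #Ш_an = 4`) the LOWER half needs `3⁴ ∣ #Ш(E)`; the tree's
Cassels–Tate squareness (`Typed/CasselsLowerBound.missingLowerBoundAt_of_casselsTate_of_pow_dvd`,
`k := 2`) turns `3³ ∣ #Ш` into it. n1011-p05's EVIDENCE (kit j157799, memo
`HOME/b2b-bsdres-n1011-p05/evidence/T-SHA81-DIM3/`) shows that on the class-A rows the rank-2
`3`-congruent partners' transported Kummer planes COINCIDE, so `3`-visibility is capped at one plane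
and the predicted shape is `Ш(E)[3^∞] ≅ (ℤ/9)²`: the usable certificate is then ONE visible class of
ORDER `9`, and the step "an element of order `9` ⟹ `81 ∣ #Ш`" needs MORE than squareness
(`#Ш = 9` is a square). This file proves that step, K-generally, from the Cassels–Tate fact alone:

* `sq_addOrderOf_dvd_natCard_of_alternating` — **for a finite abelian group `A` with a bi-additive
  ALTERNATING pairing `B : A →+ A →+ C` with trivial left kernel (and `C` such that an element of
  order `m` generates the `m`-torsion, e.g. `ℚ/ℤ`), every `x ∈ A` has `(ord x)² ∣ #A`**: with
  `χ = B x` one has `#A = #χ(A) · # ker χ`, `#χ(A) = ord x` by nondegeneracy (the tree's first step of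
  Silverman Ex. 10.20, `exists_forall_mem_zmultiples`), and `x ∈ ker χ` (alternating) so
  `ord x ∣ # ker χ` (Lagrange);
* `sq_addOrderOf_dvd_natCard_of_alternating_addCircle` — the case `C = ℚ/ℤ = AddCircle (1 : ℚ)`;
* `sq_addOrderOf_dvd_card_sha_of_casselsTate`, `pow_dvd_shaOrder_of_casselsTate_of_addOrderOf_eq`
  — **`Ш(E/K)` finite, `c ∈ Ш(E/K)` of order `p^k` ⟹ `p^{2k} ∣ #Ш(E/K)`** (`k = 2`, `p = 3`: an
  order-`9` class gives `81 ∣ #Ш`), and the typed LOWER half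
  `missingLowerBoundAt_of_casselsTate_of_addOrderOf_eq`: `ord_p #Ш_an ≤ 2k` + such a `c` ⟹
  `MissingLowerBoundAt W p`;
* `pow_four_dvd_card_sha_of_casselsTate_of_le_natCard` / `…shaOrder…` — **a subgroup `X ≤ Ш`
  killed by `p²` with `#X ≥ p³` forces `p⁴ ∣ #Ш`** (order-`p²` class present ⟹ §2; else `X` is
  killed by `p`, `p³ ∣ #Ш` by Lagrange and squareness finishes): the socket a `p²`-congruence
  visibility COUNT would end in (`p = 3`: a visible subgroup of `Ш[9]` with `≥ 27` elements ⟹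
  `81 ∣ #Ш`), with `pow_dvd_natCard_of_nsmul_eq_zero` (a finite group killed by `p` has `p`-power
  order).

References (provenance; every input used below is a theorem of the tree or Mathlib):
[SilvermanAEC2009] Thm. X.4.14 and Exercise 10.20 (a finite group with a nondegenerate alternating
pairing is `A × A`; we prove only the corollary `(ord x)² ∣ #A`); [MilneADT2006] I.6.26.
-/

noncomputable section

open scoped Classical

universe u v

namespace Summit.BirchSwinnertonDyer.Rank1Residual.GaloisImage.VisibleIndependence

open WeierstrassCurve Literature.NumberTheory.EllipticCurves
open Literature.NumberTheory.EllipticCurves.Rank1Residual.Typed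

/-! ## §1 Finite abelian groups with a nondegenerate alternating pairing -/

section Alternating

variable {C : Type*} [AddCommGroup C]
  (hC : ∀ m : ℕ, 0 < m → ∀ u w : C, addOrderOf u = m → m • w = 0 → w ∈ AddSubgroup.zmultiples u)
include hC

/-- **`(ord x)² ∣ #A` under a nondegenerate alternating pairing.** Let `A` be a finite abelian group
and `B : A →+ A →+ C` bi-additive, alternating (`B a a = 0`) with trivial left kernel, where every
element of order `m` of `C` generates the `m`-torsion of `C`. Then for every `x ∈ A`,
`(addOrderOf x)² ∣ Nat.card A`: the character `χ = B x` has image cyclic of order `ord x`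
(nondegeneracy; the tree's `exists_forall_mem_zmultiples`), `#A = #χ(A) · # ker χ`, and
`x ∈ ker χ` because `B` is alternating, so `ord x ∣ # ker χ`. (The structure theorem "`A ≅ A′ × A′`"
of Silverman Ex. 10.20 implies this; we prove the corollary directly.)
[cite: SilvermanAEC2009, Exercise 10.20] -/
theorem sq_addOrderOf_dvd_natCard_of_alternating (A : Type v) [AddCommGroup A] [Finite A]
    (B : A →+ A →+ C) (halt : ∀ a, B a a = 0) (hnd : ∀ a, (∀ b, B a b = 0) → a = 0) (x : A) :
    addOrderOf x ^ 2 ∣ Nat.card A := by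
  -- the character `χ = B x`, its kernel `H ∋ x`, and a generator `χ y₀` of its image
  set χ : A →+ C := B x with hχ_def
  set H : AddSubgroup A := χ.ker with hH_def
  have hxH : x ∈ H := by rw [hH_def, AddMonoidHom.mem_ker, hχ_def]; exact halt x
  obtain ⟨y₀, -, hy₀⟩ := exists_forall_mem_zmultiples hC χ
  set m : ℕ := addOrderOf x with hm_def
  -- `ord (χ y₀) = ord x` by nondegeneracy
  have hordx : addOrderOf (χ y₀) = m := by
    rw [hm_def, addOrderOf_eq_addOrderOf_iff]
    intro k
    constructor
    · intro hk
      apply hnd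
      intro b
      obtain ⟨l, hl⟩ := AddSubgroup.mem_zmultiples_iff.mp (hy₀ b)
      rw [map_nsmul, AddMonoidHom.nsmul_apply, ← hχ_def, ← hl, smul_comm, hk, smul_zero]
    · intro hk
      rw [hχ_def, ← AddMonoidHom.nsmul_apply, ← map_nsmul, hk, map_zero, AddMonoidHom.zero_apply]
  -- `#χ(A) = m`
  haveI : Finite χ.range := Finite.of_surjective χ.rangeRestrict χ.rangeRestrict_surjective
  have hrange : χ.range = AddSubgroup.zmultiples (χ y₀) := by
    apply le_antisymm
    · rintro _ ⟨b, rfl⟩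
      exact hy₀ b
    · exact AddSubgroup.zmultiples_le.mpr ⟨y₀, rfl⟩
  have hcard_range : Nat.card χ.range = m := by
    rw [hrange, Nat.card_zmultiples, hordx]
  -- `#A = m · #H` and `m ∣ #H` (`x ∈ H` has order `m`)
  have hcardA : Nat.card A = m * Nat.card H := by
    rw [AddSubgroup.card_eq_card_quotient_mul_card_addSubgroup H,
      Nat.card_congr (QuotientAddGroup.quotientKerEquivRange χ).toEquiv, hcard_range]
  have hmH : m ∣ Nat.card H := by
    have h := addOrderOf_dvd_natCard (⟨x, hxH⟩ : H)
    rwa [AddSubgroup.addOrderOf_mk, ← hm_def] at h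
  rw [hcardA, pow_two]
  exact Nat.mul_dvd_mul_left m hmH

omit hC in
/-- The case `C = ℚ/ℤ = AddCircle (1 : ℚ)`: under a bilinear, alternating, nondegenerate pairing
`A × A → ℚ/ℤ` on a finite abelian group, `(ord x)² ∣ #A` for every `x`
(`addCircle_mem_zmultiples_of_addOrderOf_eq`). [cite: SilvermanAEC2009, Exercise 10.20] -/
theorem sq_addOrderOf_dvd_natCard_of_alternating_addCircle (A : Type v) [AddCommGroup A] [Finite A]
    (B : A →+ A →+ AddCircle (1 : ℚ)) (halt : ∀ a, B a a = 0)
    (hnd : ∀ a, (∀ b, B a b = 0) → a = 0) (x : A) : addOrderOf x ^ 2 ∣ Nat.card A :=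
  sq_addOrderOf_dvd_natCard_of_alternating addCircle_mem_zmultiples_of_addOrderOf_eq A B halt hnd x

end Alternating

/-! ## §2 `Ш(E/K)`: an element of order `p^k` gives `p^{2k} ∣ #Ш` -/

section Sha

variable {K : Type u} [Field K] [NumberField K] (W : WeierstrassCurve K) [W.IsElliptic]

/-- **Cassels–Tate: `(ord c)² ∣ #Ш(E/K)` for every `c` in a finite `Ш(E/K)`.** The Cassels–Tate
pairing (`exists_casselsTate_pairing`, bsd.S18: alternating, kernel = divisible elements) is
nondegenerate on a finite `Ш` (`divisibleElements_eq_bot_of_finite`), and §1 applies.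
[cite: SilvermanAEC2009, Thm. X.4.14 and Exercise 10.20] -/
theorem sq_addOrderOf_dvd_card_sha_of_casselsTate (hCT : exists_casselsTate_pairing (K := K))
    [Finite W.sha] (c : W.sha) : addOrderOf c ^ 2 ∣ Nat.card W.sha := by
  obtain ⟨B, halt, hker⟩ := hCT W
  refine sq_addOrderOf_dvd_natCard_of_alternating_addCircle W.sha B halt (fun a ha => ?_) c
  have hmem : a ∈ AddSubgroup.divisibleElements W.sha := (hker a).mp ha
  rwa [divisibleElements_eq_bot_of_finite, AddSubgroup.mem_bot] at hmem

/-- **An element of order `p^k` in `Ш(E/K)` gives `p^{2k} ∣ #Ш(E/K)`** (`Ш` finite; `k = 2`,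
`p = 3`: ONE class of order `9` gives `81 ∣ #Ш` — the input the `Ш[9]`-visibility road of the SHA81
rows needs, beyond squareness). [cite: SilvermanAEC2009, Thm. X.4.14] -/
theorem pow_dvd_shaOrder_of_casselsTate_of_addOrderOf_eq (hCT : exists_casselsTate_pairing (K := K))
    (hfin : W.ShaFinite) {p k : ℕ} (c : W.sha) (hc : addOrderOf c = p ^ k) :
    p ^ (2 * k) ∣ W.shaOrder := by
  haveI : Finite W.sha := hfin
  have h := sq_addOrderOf_dvd_card_sha_of_casselsTate W hCT c
  rw [hc, ← pow_mul, mul_comm] at h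
  exact h

/-- **The typed LOWER half from ONE class of order `p^k`** (over `ℚ`): for `V / ℚ` with `Ш` finite, `#Ш_an = q` with `ord_p q ≤ 2k`, and a class `c ∈ Ш(E/ℚ)` of order `p^k`, the
typed `MissingLowerBoundAt W p` holds (`p^{2k} ∣ #Ш` by
`pow_dvd_shaOrder_of_casselsTate_of_addOrderOf_eq`, then the tree's
`missingLowerBoundAt_of_casselsTate_of_pow_dvd`). At `p = 3`, `k = 2` this is the SHA81 socket:
`ord₃ #Ш_an ≤ 4` + one visible class of order `9` ⟹ the lower half. [cite: SilvermanAEC2009, Thm. X.4.14] -/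
theorem missingLowerBoundAt_of_casselsTate_of_addOrderOf_eq (V : WeierstrassCurve ℚ) [V.IsElliptic]
    (p : ℕ) [Fact p.Prime] (hCT : exists_casselsTate_pairing (K := ℚ)) (hfin : V.ShaFinite) {q : ℚ}
    (hq : shaAn V = (q : ℂ)) {k : ℕ} (hv : padicValRat p q ≤ 2 * k) (c : V.sha)
    (hc : addOrderOf c = p ^ k) : MissingLowerBoundAt V p := by
  refine missingLowerBoundAt_of_casselsTate_of_pow_dvd V p hCT hfin hq hv ?_
  exact (pow_dvd_pow p (by omega)).trans (pow_dvd_shaOrder_of_casselsTate_of_addOrderOf_eq V hCT hfin c hc)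

end Sha

/-! ## §3 A `p²`-torsion subgroup of `Ш` with at least `p³` elements gives `p⁴ ∣ #Ш` -/

section Subgroup

variable {A : Type*} [AddCommGroup A]

/-- **A finite abelian group killed by the prime `p` has order a power of `p`**; so if it has at
least `p ^ d` elements then `p ^ d` divides its order. [folklore] -/
theorem pow_dvd_natCard_of_nsmul_eq_zero {p : ℕ} [Fact p.Prime] (Z : AddSubgroup A) [Finite Z]
    (hZ : ∀ z ∈ Z, p • z = 0) {d : ℕ} (hd : p ^ d ≤ Nat.card Z) : p ^ d ∣ Nat.card Z := by
  have hp : p.Prime := Fact.out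
  have hP : IsPGroup p (Multiplicative Z) := fun g ↦ ⟨1, by
    rw [pow_one]
    change Multiplicative.ofAdd (p • (Multiplicative.toAdd g : Z)) = Multiplicative.ofAdd 0
    congr 1
    exact Subtype.ext (hZ _ (Multiplicative.toAdd g).2)⟩
  obtain ⟨k, hk⟩ := IsPGroup.iff_card.mp hP
  have hk' : Nat.card Z = p ^ k := hk
  rw [hk'] at hd ⊢
  exact pow_dvd_pow p ((Nat.pow_le_pow_iff_right hp.one_lt).mp hd)

variable {K : Type u} [Field K] [NumberField K] (W : WeierstrassCurve K) [W.IsElliptic]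

/-- **A subgroup `X ≤ Ш(E/K)` killed by `p²` with `#X ≥ p³` forces `p⁴ ∣ #Ш(E/K)`** (`Ш` finite;
Cassels–Tate): EITHER `X` contains a class of order `p²`, and then `p⁴ ∣ #Ш`
(`sq_addOrderOf_dvd_card_sha_of_casselsTate`), OR `X` is killed by `p`, has `p`-power order
`≥ p³`, so `p³ ∣ #Ш` (Lagrange) and squareness (`isSquare_card_sha_of_finite_of_casselsTate`) gives
`p⁴ ∣ #Ш`. This is the socket a `p²`-congruence visibility count would end in (`p = 3`: a visible
subgroup of `Ш[9]` with `≥ 27` elements ⟹ `81 ∣ #Ш`, whatever its structure).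
[cite: SilvermanAEC2009, Thm. X.4.14] -/
theorem pow_four_dvd_card_sha_of_casselsTate_of_le_natCard
    (hCT : exists_casselsTate_pairing (K := K)) [Finite W.sha] {p : ℕ} [Fact p.Prime]
    (X : AddSubgroup W.sha) (hX : ∀ x ∈ X, p ^ 2 • x = 0) (hcard : p ^ 3 ≤ Nat.card X) :
    p ^ 4 ∣ Nat.card W.sha := by
  have hp : p.Prime := Fact.out
  by_cases h : ∃ x ∈ X, addOrderOf x = p ^ 2
  · obtain ⟨x, -, hx⟩ := h
    have h2 := sq_addOrderOf_dvd_card_sha_of_casselsTate W hCT x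
    rwa [hx, ← pow_mul] at h2
  · -- every element of `X` is killed by `p`
    push Not at h
    have hXp : ∀ x ∈ X, p • x = 0 := by
      intro x hx
      have hdvd : addOrderOf x ∣ p ^ 2 := addOrderOf_dvd_of_nsmul_eq_zero (hX x hx)
      obtain ⟨i, hi, hxi⟩ := (Nat.dvd_prime_pow hp).mp hdvd
      have hi1 : i ≤ 1 := by
        by_contra hi1
        have hi2 : i = 2 := by omega
        exact h x hx (by rw [hxi, hi2])
      have hdvd' : addOrderOf x ∣ p := by
        rw [hxi]
        calc p ^ i ∣ p ^ 1 := pow_dvd_pow p hi1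
          _ = p := pow_one p
      exact addOrderOf_dvd_iff_nsmul_eq_zero.mp hdvd'
    haveI : Finite X := Finite.of_injective _ (AddSubgroup.subtype_injective X)
    have h3 : p ^ 3 ∣ Nat.card W.sha :=
      (pow_dvd_natCard_of_nsmul_eq_zero X hXp hcard).trans (AddSubgroup.card_addSubgroup_dvd_card X)
    have hsq := isSquare_card_sha_of_finite_of_casselsTate hCT W
    have hn : Nat.card W.sha ≠ 0 := Nat.card_pos.ne'
    have hle : 2 * 2 ≤ padicValNat p (Nat.card W.sha) :=
      two_mul_le_padicValNat_of_isSquare_of_pow_dvd hsq hn (k := 2) (by simpa using h3)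
    exact (padicValNat_dvd_iff_le hn).mpr (by simpa using hle)

/-- `shaOrder` form: **`X ≤ Ш(E/K)` with `p² X = 0` and `#X ≥ p³` ⟹ `p⁴ ∣ #Ш(E/K)`** (`Ш` finite).
[cite: SilvermanAEC2009, Thm. X.4.14] -/
theorem pow_four_dvd_shaOrder_of_casselsTate_of_le_natCard
    (hCT : exists_casselsTate_pairing (K := K)) (hfin : W.ShaFinite) {p : ℕ} [Fact p.Prime]
    (X : AddSubgroup W.sha) (hX : ∀ x ∈ X, p ^ 2 • x = 0) (hcard : p ^ 3 ≤ Nat.card X) :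
    p ^ 4 ∣ W.shaOrder := by
  haveI : Finite W.sha := hfin
  exact pow_four_dvd_card_sha_of_casselsTate_of_le_natCard W hCT X hX hcard

end Subgroup

end Summit.BirchSwinnertonDyer.Rank1Residual.GaloisImage.VisibleIndependence

end
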